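import Summits.NavierStokesRegularity.FluidComputer.ClayBlowupForcedAlignment
import HarnessLib

/-!
# The zoom with force under a Type I bound: Type I decay of the limit, and the end-game «a
# slice-constant zoom limit is impossible»

Cell `ns-blowup`, seat `ns-blowup-ecbridge-2` (g10; the E–C endpoint theory seat). LABEL: E–C typing
(KERNEL — no named fact). WHAT THIS IS NOT: not Navier–Stokes evidence — necessary structure of the
TYPE `ClayBlowup 1` (no inhabitant is claimed anywhere). Companion memo:
`run/shared/lean/pub/ns-blowup/ecbridge2/ECBRIDGE-2-MEMO-9.md`.

Two tools shared by the Type-I rows built on `ClayBlowup.exists_zoom_limit` (Giga–Miura with force,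
`ClayBlowupForcedAlignmentOne.lean`, where they were proved inline; the axisymmetric Type-I row,
`ClayBlowupForcedAxisymTypeI.lean`):

* `ClayBlowup.typeI_decay_of_zoom` — if `‖u(t,x)‖ ≤ C/√(T − t)` near `T`, every pointwise limit
  `W(s, y)` of the zooms `c_j u(t_j + c_j² s, x_j + c_j y)` along near-maximum data (`t_j ∈ (0,T)`,
  `‖u(t_j, x_j)‖ ≥ j + 1`, `c_j = ‖u(t_j,x_j)‖⁻¹`) satisfies `√(−s) ‖W(s, y)‖ ≤ C` for `s < 0`
  (Giga–Miura 2011, p. 6: `‖u_k‖(t) ≤ C₀(M_k²|t_k| + |t|)^{−1/2} ≤ C₀(−t)^{−1/2}`; here through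
  `T − t'_j ≥ c_j²(−s)` at the slice time `t'_j = t_j + c_j² s`);
* `false_of_sliceConst_of_typeI_decay` — a field on `(−∞, 0) × ℝ³` with `C²` slices, bounded,
  weakly divergence free, Oseen-mild, non-trivial, with Type I decay, CANNOT be constant in space on
  every slice (KNSS Remark 6.1 + decay: the tree's `gigaMiura2011_curl_not_identically_zero_of_typeI`
  fed with the vanishing curl of constant slices).

References: Y. Giga, H. Miura, Comm. Math. Phys. 303 (2011), §2.1 (p. 6) and Prop. 2.1
[cite: GigaMiura2011, §2.1 and Prop. 2.1]; Koch–Nadirashvili–Seregin–Šverák, Acta Math. 203 (2009),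
Remark 6.1 [cite: KochNadirashviliSereginSverak2009, Remark 6.1].
-/

noncomputable section

namespace Summit.NavierStokesRegularity.FluidComputer

open Set MeasureTheory Filter Topology Function Metric
open scoped ENNReal NNReal
open Literature.Analysis Literature.Analysis.FluidPDE
open Summit.NavierStokesRegularity.NavierStokesRegularity

/-! ## §1 The end-game -/

/-- The curl of a field that is constant in space vanishes. [folklore] -/
theorem curl_eq_zero_of_forall_eq {v : EuclideanSpace ℝ (Fin 3) → EuclideanSpace ℝ (Fin 3)}
    (h : ∀ y, v y = v 0) (y : EuclideanSpace ℝ (Fin 3)) : curl v y = 0 := by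
  have e : v = fun _ => v 0 := funext h
  rw [e, curl_eq_curlCLM, fderiv_const_apply, map_zero]

/-- **A slice-constant zoom limit is impossible under Type I** (no named fact): a field on
`(−∞, 0) × ℝ³` with `C²` slices, bounded, weakly divergence free and Oseen-mild (`ν = 1`), non-trivial
at some negative time and with the Type-I decay `√(−s)‖V(s,y)‖ ≤ C`, is NOT constant in space on
every slice: constant slices are curl free, against the tree's
`gigaMiura2011_curl_not_identically_zero_of_typeI` (KNSS Remark 6.1 makes the constant
time-independent, the decay makes it zero, non-triviality forbids that).
[cite: GigaMiura2011, Prop. 2.1] [cite: KochNadirashviliSereginSverak2009, Remark 6.1] -/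
theorem false_of_sliceConst_of_typeI_decay {C : ℝ}
    {V : ℝ → EuclideanSpace ℝ (Fin 3) → EuclideanSpace ℝ (Fin 3)}
    (hC2 : ∀ s < 0, ContDiff ℝ 2 (V s)) (hbd : ∃ K : ℝ, ∀ s < 0, ∀ y, ‖V s y‖ ≤ K)
    (hdiv : ∀ s < 0, IsWeaklyDivFree (V s))
    (hmild : ∀ s τ : ℝ, s < τ → τ < 0 → ∀ y,
      V τ y = UnboundedOperators.heatExtension (V s) (τ - s) y - oseenDuhamel 1 s V V τ y)
    (hnt : ∃ s < 0, ∃ y, V s y ≠ 0) (hI : ∀ s < 0, ∀ y, Real.sqrt (-s) * ‖V s y‖ ≤ C)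
    (hconst : ∀ s < 0, ∀ y, V s y = V s 0) : False :=
  gigaMiura2011_curl_not_identically_zero_of_typeI (C₀ := C) hC2 hbd hdiv hmild hnt hI
    fun s hs y => curl_eq_zero_of_forall_eq (hconst s hs) y

namespace ClayBlowup

/-! ## §2 Type I passes to the zoom limit -/

/-- **TYPE I PASSES TO THE ZOOM LIMIT** (`ν = 1`; Giga–Miura 2011, p. 6, here WITH the Clay force and
without convergence beyond pointwise): if `‖u(t, x)‖ ≤ C/√(T − t)` for `t` near `T`, and `W(s, ·)` is
the pointwise limit at `s < 0` of the zooms along near-maximum data (`t_j ∈ (0, T)`,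
`‖u(t_j,x_j)‖ ≥ j + 1`, `c_j = ‖u(t_j,x_j)‖⁻¹`, subsequence `φ`), then `√(−s) ‖W(s, y)‖ ≤ C`: at the
slice time `t'_j = t_j + c_j² s` one has `T − t'_j ≥ c_j²(−s)`, so
`c_j ‖u(t'_j, ·)‖ ≤ c_j C/√(T − t'_j) ≤ C/√(−s)`. [cite: GigaMiura2011, §2.1 (p. 6)] -/
theorem typeI_decay_of_zoom (Y : ClayBlowup 1) {C : ℝ}
    (hC : ∀ᶠ t in 𝓝[<] Y.T, ∀ x, ‖Y.u t x‖ ≤ C / Real.sqrt (Y.T - t))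
    {t : ℕ → ℝ} {x : ℕ → EuclideanSpace ℝ (Fin 3)} {c : ℕ → ℝ} {φ : ℕ → ℕ}
    {W : ℝ → EuclideanSpace ℝ (Fin 3) → EuclideanSpace ℝ (Fin 3)}
    (ht : ∀ k, t k ∈ Ioo 0 Y.T) (hc : ∀ k, c k = ‖Y.u (t k) (x k)‖⁻¹)
    (hk1 : ∀ k : ℕ, (k : ℝ) + 1 ≤ ‖Y.u (t k) (x k)‖) (hφ : StrictMono φ)
    (hconv : ∀ s < 0, ∀ y, Tendsto
      (fun j => (c (φ j) • stPull (c (φ j) ^ 2) (c (φ j)) (t (φ j)) (x (φ j)) Y.u) s y) atTop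
      (𝓝 (W s y))) :
    ∀ s < 0, ∀ y, Real.sqrt (-s) * ‖W s y‖ ≤ C := by
  have hT := Y.T_pos
  have hM0 : ∀ k, 0 < ‖Y.u (t k) (x k)‖ := fun k => lt_of_lt_of_le (by positivity) (hk1 k)
  have hc0 : ∀ k, 0 < c k := fun k => by rw [hc k]; exact inv_pos.2 (hM0 k)
  -- the slice times tend to `T` from below
  have htT : Tendsto t atTop (𝓝[<] Y.T) := Y.tendsto_of_norm_ge one_pos ht hk1
  have hcto : Tendsto c atTop (𝓝 0) := by
    have hMto : Tendsto (fun k => ‖Y.u (t k) (x k)‖) atTop atTop := by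
      refine tendsto_atTop_atTop.2 fun B => ⟨⌈B⌉₊, fun k hk => ?_⟩
      have h1 : (⌈B⌉₊ : ℝ) ≤ k := by exact_mod_cast hk
      linarith [Nat.le_ceil B, hk1 k]
    exact (tendsto_inv_atTop_zero.comp hMto).congr fun k => by simp [Function.comp, hc k]
  have htime : ∀ s ≤ 0, Tendsto (fun j => t (φ j) + c (φ j) ^ 2 * s) atTop (𝓝[<] Y.T) := by
    intro s hs
    have h1 : Tendsto (fun j => t (φ j)) atTop (𝓝 Y.T) :=
      (tendsto_nhdsWithin_iff.1 htT).1.comp hφ.tendsto_atTop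
    have h2 : Tendsto (fun j => c (φ j) ^ 2 * s) atTop (𝓝 0) := by
      simpa using ((hcto.comp hφ.tendsto_atTop).pow 2).mul_const s
    refine tendsto_nhdsWithin_iff.2 ⟨by simpa using h1.add h2, Eventually.of_forall fun j => ?_⟩
    have : c (φ j) ^ 2 * s ≤ 0 := mul_nonpos_of_nonneg_of_nonpos (sq_nonneg _) hs
    exact lt_of_le_of_lt (by linarith) (ht (φ j)).2
  intro s hs y
  have hs0 : 0 < Real.sqrt (-s) := Real.sqrt_pos.2 (by linarith)
  refine le_of_tendsto ((hconv s hs y).norm.const_mul _) ?_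
  filter_upwards [(htime s hs.le).eventually hC] with j hj
  rw [smul_stPull_apply, norm_smul, Real.norm_of_nonneg (hc0 _).le]
  have h1 := hj (x (φ j) + c (φ j) • y)
  -- `c √(−s) ≤ √(T − t')`
  have h2 : c (φ j) * Real.sqrt (-s) ≤ Real.sqrt (Y.T - (t (φ j) + c (φ j) ^ 2 * s)) := by
    have e1 : c (φ j) * Real.sqrt (-s) = Real.sqrt (c (φ j) ^ 2 * -s) := by
      rw [Real.sqrt_mul (sq_nonneg _), Real.sqrt_sq (hc0 _).le]
    rw [e1]
    refine Real.sqrt_le_sqrt ?_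
    have e2 : c (φ j) ^ 2 * -s = -(c (φ j) ^ 2 * s) := by ring
    rw [e2]
    linarith [(ht (φ j)).2]
  have hTt : 0 < Real.sqrt (Y.T - (t (φ j) + c (φ j) ^ 2 * s)) :=
    lt_of_lt_of_le (mul_pos (hc0 _) hs0) h2
  have hC0 : 0 ≤ C := by
    have h0 := (norm_nonneg _).trans h1
    exact (div_nonneg_iff.1 h0).elim (fun h => h.1) fun h => absurd h.2 (not_le.2 hTt)
  have hcφ : 0 ≤ c (φ j) := (hc0 _).le
  calc Real.sqrt (-s) * (c (φ j) * ‖Y.u (t (φ j) + c (φ j) ^ 2 * s) (x (φ j) + c (φ j) • y)‖)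
      ≤ Real.sqrt (-s) * (c (φ j) * (C / Real.sqrt (Y.T - (t (φ j) + c (φ j) ^ 2 * s)))) := by
        gcongr
    _ = C * (c (φ j) * Real.sqrt (-s) / Real.sqrt (Y.T - (t (φ j) + c (φ j) ^ 2 * s))) := by
        ring
    _ ≤ C * 1 := by
        gcongr
        rw [div_le_one hTt]; exact h2
    _ = C := mul_one C

/-- **The slice times of the zoom eventually lie in `(0, t_j]`** for `s ≤ 0` (so the near-maximum
bound and the classical regularity apply there). [folklore] -/
theorem zoom_time_mem_eventually (Y : ClayBlowup 1) {t : ℕ → ℝ} {x : ℕ → EuclideanSpace ℝ (Fin 3)}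
    {c : ℕ → ℝ} {φ : ℕ → ℕ} (ht : ∀ k, t k ∈ Ioo 0 Y.T) (hc : ∀ k, c k = ‖Y.u (t k) (x k)‖⁻¹)
    (hk1 : ∀ k : ℕ, (k : ℝ) + 1 ≤ ‖Y.u (t k) (x k)‖) (hφ : StrictMono φ) {s : ℝ} (hs : s ≤ 0) :
    ∀ᶠ j in atTop, t (φ j) + c (φ j) ^ 2 * s ∈ Ioc 0 (t (φ j)) := by
  have hT := Y.T_pos
  have hM0 : ∀ k, 0 < ‖Y.u (t k) (x k)‖ := fun k => lt_of_lt_of_le (by positivity) (hk1 k)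
  have htT : Tendsto t atTop (𝓝[<] Y.T) := Y.tendsto_of_norm_ge one_pos ht hk1
  have hcto : Tendsto c atTop (𝓝 0) := by
    have hMto : Tendsto (fun k => ‖Y.u (t k) (x k)‖) atTop atTop := by
      refine tendsto_atTop_atTop.2 fun B => ⟨⌈B⌉₊, fun k hk => ?_⟩
      have h1 : (⌈B⌉₊ : ℝ) ≤ k := by exact_mod_cast hk
      linarith [Nat.le_ceil B, hk1 k]
    exact (tendsto_inv_atTop_zero.comp hMto).congr fun k => by simp [Function.comp, hc k]
  have h1 : Tendsto (fun j => t (φ j)) atTop (𝓝 Y.T) :=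
    (tendsto_nhdsWithin_iff.1 htT).1.comp hφ.tendsto_atTop
  have h2 : Tendsto (fun j => c (φ j) ^ 2 * s) atTop (𝓝 0) := by
    simpa using ((hcto.comp hφ.tendsto_atTop).pow 2).mul_const s
  have h3 : Tendsto (fun j => t (φ j) + c (φ j) ^ 2 * s) atTop (𝓝 Y.T) := by simpa using h1.add h2
  filter_upwards [h3.eventually (Ioi_mem_nhds hT)] with j hj
  have : c (φ j) ^ 2 * s ≤ 0 := mul_nonpos_of_nonneg_of_nonpos (sq_nonneg _) hs
  exact ⟨hj, by linarith⟩

end ClayBlowup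

end Summit.NavierStokesRegularity.FluidComputer

end
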